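import Literature.Analysis.FluidPDE.PeriodicLerayLimitLocalEnergy
import Literature.Analysis.FluidPDE.PeriodicLerayLimitPeriodicity
import Literature.Analysis.FluidPDE.PeriodicLerayLimitVelocity
import Literature.Analysis.FluidPDE.PeriodicLerayLimitPressure
import Literature.Analysis.FluidPDE.SuitableWeakCongr
import HarnessLib

/-!
# [BT1] proof of Theorem 2.4, the limit `ε → 0`: the discharge

Analysis/FluidPDE proof file (theorems only, no new definitions, no named facts): the **discharge
of the named fact `Literature.Analysis.FluidPDE.bradshawTsai2017_thm_2_4_limit`**
(`PeriodicLerayExistence.lean`; Bradshaw–Tsai, *Forward discretely self-similar solutions of the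
Navier–Stokes equations II*, Ann. Henri Poincaré 18 (2017) = arXiv:1510.07504 [BT1], §2, the last
part of the proof of Thm 2.4, p. 10 of the arXiv version):
`theorem bradshawTsai2017_thm_2_4_limit_holds : bradshawTsai2017_thm_2_4_limit`.

## The proof, assembled from parts I–IX

* *Extraction* ("there exists … `U` … and a sequence … `U_{ε_k} → U` … strongly in
  `L²(0,T;H(K))` for all compact `K`"): `exists_velocity_limit` (parts I–II: Aubin–Lions on the
  cylinders and a diagonal subsequence), `exists_subseq_pressure_limit` (part III: "`p_{ε_k} → p`
  weakly in `L^{5/3}`"), `exists_gradient_limit` (part IV: `∇U_{ε_k} ⇀ ∇U` weakly in `L²` of the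
  slabs), along one common subsequence; the mollified drifts converge by part V.
* *Representatives*: the limits are `T`-periodic a.e. (part IX); their periodisations, with the
  velocity set to `0` on the null set of bad time slices, are literally periodic, satisfy
  `‖U(s)‖_{L²} ≤ C` for every `s`, and agree with the limits a.e.
* *"this convergence is strong enough to ensure that `(u,p)` solves (2.1) in the distributional
  sense"*: parts VI (distributional system, `div u = 0`) and VII (the weak form (2.2) against `𝒟_T`).
* *"It remains to check that the pair `(u,p)` is suitable. This follows as in [CKN]"*: part VIII.
* The classes of Def. 2.3: `u − U₀ = U + (W − U₀) ∈ L^∞L²`, `∇(u − U₀) = ∇U + ∇(W − U₀) ∈ L²`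
  on a period from the bounds on `U` and the hypotheses on `U₀ − W`; `p ∈ L^{5/3}_loc ⊂ L^{3/2}_loc`.

## References

* Z. Bradshaw, T.-P. Tsai, Ann. Henri Poincaré 18 (2017) 1095–1119 = arXiv:1510.07504, §2,
  Defs. 2.2–2.3, Thm 2.4 and its proof [BradshawTsai2017AHP].
* L. Caffarelli, R. Kohn, L. Nirenberg, Comm. Pure Appl. Math. 35 (1982) [CaffarelliKohnNirenberg1982].
* R. Temam, *Navier–Stokes equations* (1977/79), Ch. III [Temam1979].
-/

noncomputable section

open MeasureTheory TopologicalSpace Set Function Filter Metric Bornology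
open scoped NNReal ENNReal Topology InnerProductSpace RealInnerProductSpace Laplacian

namespace Literature.Analysis.FluidPDE

namespace BradshawTsai2017

/-! ### Small helpers -/

section Helpers

/-- Every cylinder `(a,b) × B(0,R)` lies in one of the cylinders `Q_n = (−n−1,n+1) × B(0,n+1)`.
[folklore] -/
theorem exists_cylinder_subset (a b R : ℝ) : ∃ n : ℕ,
    Ioo a b ×ˢ ball (0 : EuclideanSpace ℝ (Fin 3)) R ⊆
      Ioo (-((n : ℝ) + 1)) ((n : ℝ) + 1) ×ˢ ball (0 : EuclideanSpace ℝ (Fin 3)) (n + 1) := by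
  refine ⟨⌈max (max |a| |b|) |R|⌉₊, ?_⟩
  have h1 : max (max |a| |b|) |R| ≤ (⌈max (max |a| |b|) |R|⌉₊ : ℝ) := Nat.le_ceil _
  have ha : |a| ≤ (⌈max (max |a| |b|) |R|⌉₊ : ℝ) := ((le_max_left _ _).trans (le_max_left _ _)).trans h1
  have hb : |b| ≤ (⌈max (max |a| |b|) |R|⌉₊ : ℝ) := ((le_max_right _ _).trans (le_max_left _ _)).trans h1
  have hR : |R| ≤ (⌈max (max |a| |b|) |R|⌉₊ : ℝ) := (le_max_right _ _).trans h1
  refine prod_mono (fun s hs => ⟨?_, ?_⟩) (ball_subset_ball (by linarith [le_abs_self R]))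
  · linarith [hs.1, neg_abs_le a]
  · linarith [hs.2, le_abs_self b]

/-- `∫⁻ ‖f‖ₑ³ < ∞` for `f ∈ L³`. [folklore] -/
theorem lintegral_rpow_three_lt_top_of_memLp {X : Type*} [MeasurableSpace X] {μ : Measure X}
    {F : Type*} [NormedAddCommGroup F] {f : X → F} (hf : MemLp f 3 μ) :
    ∫⁻ x, ‖f x‖ₑ ^ (3 : ℝ) ∂μ < ∞ := by
  have h := hf.2
  rw [eLpNorm_three_eq_rpow] at h
  exact (ENNReal.rpow_lt_top_iff_of_pos (by norm_num)).1 h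

/-- From `∫⁻_{S} ‖q‖ₑ^{5/3} < ∞` on a larger window to integrability on a finite-measure
cylinder. [folklore] -/
theorem integrableOn_cylinder_of_lintegral_fiveThirds {q : ℝ → EuclideanSpace ℝ (Fin 3) → ℝ}
    (hqm : AEStronglyMeasurable (uncurry q) (volume : Measure (ℝ × EuclideanSpace ℝ (Fin 3))))
    (h : ∀ a b : ℝ, ∫⁻ z in Ioo a b ×ˢ (univ : Set (EuclideanSpace ℝ (Fin 3))), ‖q z.1 z.2‖ₑ ^ (5 / 3 : ℝ) < ∞)
    (a b R : ℝ) :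
    IntegrableOn (uncurry q) (Ioo a b ×ˢ ball (0 : EuclideanSpace ℝ (Fin 3)) R) volume := by
  haveI : IsFiniteMeasure (volume.restrict (Ioo a b ×ˢ ball (0 : EuclideanSpace ℝ (Fin 3)) R)) :=
    NSCylinder.isFiniteMeasure_restrict (Ω := ⟨ball (0 : EuclideanSpace ℝ (Fin 3)) R, isOpen_ball⟩) isBounded_ball a b
  exact integrable_of_lintegral_rpow_fiveThirds_lt_top hqm.restrict
    ((lintegral_mono_set (prod_mono Subset.rfl (subset_univ _))).trans_lt (h a b))

end Helpers

/-! ### The discharge -/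

section Discharge

set_option maxHeartbeats 1600000 in
/-- **[BT1] proof of Theorem 2.4, the limit `ε → 0` — discharge of the named fact
`bradshawTsai2017_thm_2_4_limit`.** "Because `U_ε` are bounded independently of `ε` in
`L^∞(0,T;L²(ℝ³)) ∩ L²(0,T;H¹₀(ℝ³))` … there exists … `U` … and a sequence … `U_{ε_k} → U` weakly in
`L²(0,T;X)`, strongly in `L²(0,T;H(K))` for all compact `K` … Let `u = U + W`. … `p_{ε_k} → p`
weakly in `L^{5/3}(ℝ³ × [0,T])` … this convergence is strong enough to ensure that `(u,p)` solves
(2.1) in the distributional sense. It remains to check that the pair `(u,p)` is suitable. This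
follows as in [CKN] since the approximating solutions `(u_ε,p_ε)` all satisfy the local energy
equality." Assembled from `exists_velocity_limit`, `exists_subseq_pressure_limit`,
`exists_gradient_limit`, `tendsto_eLpNorm_mollify_sub_limit`, the periodic representatives of
part IX, and the passages to the limit `distributional_limit`, `ae_isWeaklyDivFree_limit`,
`weakForm_limit`, `localEnergy_limit`. [cite: BradshawTsai2017AHP, proof of Thm 2.4 (limit ε → 0, suitability)] -/
theorem _root_.Literature.Analysis.FluidPDE.bradshawTsai2017_thm_2_4_limit_holds :
    bradshawTsai2017_thm_2_4_limit := by
  intro T hT U₀ W α hU₀ hW h1 h2 η hη C ε U p hε hε0 hsol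
  have hWc1 : ContDiff ℝ 1 (uncurry W) := hW.contDiff
  have hUm : ∀ k, AEStronglyMeasurable (uncurry (U k)) (volume : Measure (ℝ × EuclideanSpace ℝ (Fin 3))) :=
    fun k => (hsol k).aestronglyMeasurable_velocity
  have hU2Q : ∀ k (n : ℕ), ∫⁻ z in Ioo (-((n : ℝ) + 1)) ((n : ℝ) + 1) ×ˢ ball (0 : EuclideanSpace ℝ (Fin 3)) (n + 1),
      ‖U k z.1 z.2‖ₑ ^ 2 < ∞ := fun k n =>
    ((hsol k).lintegral_cylinder_sq_le _ _ 0 _).trans_lt (ENNReal.mul_lt_top ENNReal.ofReal_lt_top ENNReal.coe_lt_top)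
  ------------------------------------------------------------------
  -- ## Step 1: extraction of the limits along one subsequence
  ------------------------------------------------------------------
  obtain ⟨φ, Ul0, hφ, hUl0m, hslice0, hM0, hconv2φ, hconv3φ, -⟩ := exists_velocity_limit hT hWc1 hη hε hsol
  -- the pressures along `φ`
  set Kp : ℝ≥0∞ := 2 * (⌈(2 : ℝ) / T⌉₊ + 1 : ℕ) * (C : ℝ≥0∞) with hKp
  have hKptop : Kp ≠ ∞ := ENNReal.mul_ne_top (ENNReal.mul_ne_top ENNReal.ofNat_ne_top (ENNReal.natCast_ne_top _)) ENNReal.coe_ne_top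
  have hπb : ∀ k (a : ℝ), ∫⁻ z in Ioo (a - 1) (a + 1) ×ˢ (univ : Set (EuclideanSpace ℝ (Fin 3))),
      ‖p (φ k) z.1 z.2‖ₑ ^ (5 / 3 : ℝ) ≤ Kp := by
    intro k a
    have h := (hsol (φ k)).lintegral_window_pressure_le hT (a - 1) (a + 1)
    rwa [show a + 1 - (a - 1) = (2 : ℝ) by ring] at h
  obtain ⟨σ, pl0, hσ, hpl0m, -, hpl0win, hpwσ⟩ := exists_subseq_pressure_limit (π := fun k => p (φ k))
    (fun k => (hsol (φ k)).aestronglyMeasurable_pressure) hKptop hπb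
  have hpl053 : ∀ a b : ℝ, ∫⁻ z in Ioo a b ×ˢ (univ : Set (EuclideanSpace ℝ (Fin 3))), ‖pl0 z.1 z.2‖ₑ ^ (5 / 3 : ℝ) < ∞ :=
    fun a b => (hpl0win a b).trans_lt (ENNReal.mul_lt_top ENNReal.ofReal_lt_top
      (ENNReal.mul_lt_top (ENNReal.mul_lt_top ENNReal.ofNat_lt_top hKptop.lt_top)
        (ENNReal.inv_lt_top.2 (tsub_pos_of_lt (ENNReal.ofReal_lt_one.2 (Real.exp_lt_one_iff.2 (by norm_num)))))))
  -- the gradients along `φ ∘ σ`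
  choose G hG using fun k => (hsol k).weakForm
  obtain ⟨κ, Gu, hκ, hGu0, hGub0, hGwκ⟩ := exists_gradient_limit (C := C) hT (U := U) (G := G)
    (fun k => (hsol k).periodic) (fun k => (hG k).1) (fun k => (hG k).2.1) hU2Q (φ := φ ∘ σ) (u := Ul0) hUl0m
    (fun n => (hconv2φ n).comp hσ.tendsto_atTop)
  -- the final subsequence
  set τ : ℕ → ℕ := fun k => φ (σ (κ k)) with hτ
  have hτm : StrictMono τ := hφ.comp (hσ.comp hκ)
  have hετ : ∀ k, 0 < ε (τ k) := fun k => hε _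
  have hετ0 : Tendsto (fun k => ε (τ k)) atTop (𝓝 0) := hε0.comp hτm.tendsto_atTop
  have hsolτ : ∀ k, IsMollifiedPeriodicWeakSolution T W η (ε (τ k)) C (U (τ k)) (p (τ k)) := fun k => hsol _
  have hconv2τ : ∀ n : ℕ, Tendsto (fun k => ∫⁻ z in Ioo (-((n : ℝ) + 1)) ((n : ℝ) + 1) ×ˢ
      ball (0 : EuclideanSpace ℝ (Fin 3)) (n + 1), ‖U (τ k) z.1 z.2 - Ul0 z.1 z.2‖ₑ ^ 2) atTop (𝓝 0) :=
    fun n => (hconv2φ n).comp ((hσ.comp hκ).tendsto_atTop)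
  have hconv3τ : ∀ n : ℕ, Tendsto (fun k => ∫⁻ z in Ioo (-((n : ℝ) + 1)) ((n : ℝ) + 1) ×ˢ
      ball (0 : EuclideanSpace ℝ (Fin 3)) (n + 1), ‖U (τ k) z.1 z.2 - Ul0 z.1 z.2‖ₑ ^ (3 : ℝ)) atTop (𝓝 0) :=
    fun n => (hconv3φ n).comp ((hσ.comp hκ).tendsto_atTop)
  have hpwτ : ∀ (a b R : ℝ) (h : ℝ × EuclideanSpace ℝ (Fin 3) → ℝ),
      MemLp h (5 / 2 : ℝ≥0∞) (volume.restrict (Ioo a b ×ˢ ball (0 : EuclideanSpace ℝ (Fin 3)) R)) →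
      Tendsto (fun k => ∫ z in Ioo a b ×ˢ ball (0 : EuclideanSpace ℝ (Fin 3)) R, p (τ k) z.1 z.2 * h z) atTop
        (𝓝 (∫ z in Ioo a b ×ˢ ball (0 : EuclideanSpace ℝ (Fin 3)) R, pl0 z.1 z.2 * h z)) :=
    fun a b R h hh => (hpwσ a b R h hh).comp hκ.tendsto_atTop
  ------------------------------------------------------------------
  -- ## Step 2: a.e. periodicity and the periodic representatives
  ------------------------------------------------------------------
  -- `Ul0` and `pl0` are invariant a.e. under all period shifts
  have hUper : ∀ k : ℤ, ∀ᵐ z : ℝ × EuclideanSpace ℝ (Fin 3), Ul0 (z.1 + k * T) z.2 = Ul0 z.1 z.2 := by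
    intro k
    refine ae_comp_timeShift_eq_of_limit (U := fun j => U (φ j)) (fun j => hUm _) (fun j s y => ?_) hUl0m hconv2φ
    have hp : Function.Periodic (fun s => U (φ j) s y) T := fun s => (hsol (φ j)).periodic s y
    exact hp.int_mul k s
  have hpl0i : ∀ a b R : ℝ, IntegrableOn (uncurry pl0) (Ioo a b ×ˢ ball (0 : EuclideanSpace ℝ (Fin 3)) R) volume :=
    integrableOn_cylinder_of_lintegral_fiveThirds hpl0m hpl053
  have hpper : ∀ k : ℤ, ∀ᵐ z : ℝ × EuclideanSpace ℝ (Fin 3), pl0 (z.1 + k * T) z.2 = pl0 z.1 z.2 := by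
    intro k
    refine ae_comp_timeShift_eq_of_weak_limit (p := fun j => p (φ (σ j))) (fun j s y => ?_) hpl0i hpwσ
    have hp : Function.Periodic (fun s => p (φ (σ j)) s y) T := fun s => (hsol (φ (σ j))).periodic_pressure s y
    exact hp.int_mul k s
  -- the periodisations
  set Ulp : ℝ → EuclideanSpace ℝ (Fin 3) → EuclideanSpace ℝ (Fin 3) := fun s y => Ul0 (Int.fract (s / T) * T) y with hUlp
  set plp : ℝ → EuclideanSpace ℝ (Fin 3) → ℝ := fun s y => pl0 (Int.fract (s / T) * T) y with hplp
  have hUlp_ae : ∀ᵐ z : ℝ × EuclideanSpace ℝ (Fin 3), Ulp z.1 z.2 = Ul0 z.1 z.2 := ae_periodize_eq hT hUper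
  have hplp_ae : ∀ᵐ z : ℝ × EuclideanSpace ℝ (Fin 3), plp z.1 z.2 = pl0 z.1 z.2 := ae_periodize_eq hT hpper
  have hUlp_per : ∀ s y, Ulp (s + T) y = Ulp s y := fun s y => periodize_add hT.ne' Ul0 s y
  have hplp_per : ∀ s y, plp (s + T) y = plp s y := fun s y => periodize_add hT.ne' pl0 s y
  -- the good time slices and the velocity representative
  set GoodT : Set ℝ := {s | AEStronglyMeasurable (Ulp s) (volume : Measure (EuclideanSpace ℝ (Fin 3))) ∧
    ∫⁻ y, ‖Ulp s y‖ₑ ^ 2 ≤ C} with hGoodT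
  set Uf : ℝ → EuclideanSpace ℝ (Fin 3) → EuclideanSpace ℝ (Fin 3) := GoodT.indicator Ulp with hUf
  have hGoodT_per : ∀ s, s + T ∈ GoodT ↔ s ∈ GoodT := by
    intro s
    have e : Ulp (s + T) = Ulp s := funext (hUlp_per s)
    simp only [hGoodT, mem_setOf_eq, e]
  have hUf_per : ∀ s y, Uf (s + T) y = Uf s y := by
    intro s y
    rw [hUf]
    by_cases hs : s ∈ GoodT
    · rw [indicator_of_mem ((hGoodT_per s).2 hs), indicator_of_mem hs, hUlp_per]
    · rw [indicator_of_notMem (fun h => hs ((hGoodT_per s).1 h)), indicator_of_notMem hs]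
  have hUf_good : ∀ s ∈ GoodT, Uf s = Ulp s := fun s hs => by rw [hUf, indicator_of_mem hs]
  have hUf_bad : ∀ s, s ∉ GoodT → Uf s = 0 := fun s hs => by rw [hUf, indicator_of_notMem hs]
  -- almost every slice is good
  have hslice_Ul0 : ∀ᵐ s : ℝ, ∫⁻ y, ‖Ul0 s y‖ₑ ^ 2 ≤ C := ae_lintegral_sq_le_of_forall_ball hslice0
  have hgood_ae : ∀ᵐ s : ℝ, s ∈ GoodT := by
    have h1 : ∀ᵐ s : ℝ, ∀ᵐ y : EuclideanSpace ℝ (Fin 3), Ulp s y = Ul0 s y := by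
      have h := hUlp_ae
      rw [Measure.volume_eq_prod] at h
      exact Measure.ae_ae_of_ae_prod h
    have h2 : ∀ᵐ s : ℝ, AEStronglyMeasurable (Ul0 s) (volume : Measure (EuclideanSpace ℝ (Fin 3))) := by
      have h := hUl0m
      rw [Measure.volume_eq_prod] at h
      exact h.prodMk_left
    filter_upwards [h1, h2, hslice_Ul0] with s hs1 hs2 hs3
    have hae : Ulp s =ᵐ[volume] Ul0 s := hs1
    refine ⟨hs2.congr hae.symm, ?_⟩
    rw [lintegral_congr_ae (hae.mono fun y hy => by rw [hy])]
    exact hs3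
  -- `Uf = Ul0` a.e.
  have hUf_ae : ∀ᵐ z : ℝ × EuclideanSpace ℝ (Fin 3), Uf z.1 z.2 = Ul0 z.1 z.2 := by
    have h1 : ∀ᵐ z : ℝ × EuclideanSpace ℝ (Fin 3), z.1 ∈ GoodT := by
      have h := (Measure.quasiMeasurePreserving_fst (μ := (volume : Measure ℝ))
        (ν := (volume : Measure (EuclideanSpace ℝ (Fin 3))))).ae hgood_ae
      rw [← Measure.volume_eq_prod] at h
      exact h
    filter_upwards [h1, hUlp_ae] with z hz1 hz2
    rw [hUf_good z.1 hz1]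
    exact hz2
  have hUfm : AEStronglyMeasurable (uncurry Uf) (volume : Measure (ℝ × EuclideanSpace ℝ (Fin 3))) :=
    hUl0m.congr (hUf_ae.mono fun z hz => by simp only [uncurry]; exact hz.symm)
  have hUf_energy : ∀ s, ∫⁻ y, ‖Uf s y‖ₑ ^ 2 ≤ C := by
    intro s
    by_cases hs : s ∈ GoodT
    · rw [hUf_good s hs]; exact hs.2
    · rw [hUf_bad s hs]; simp
  have hUf_slice2 : ∀ s, MemLp (Uf s) 2 (volume : Measure (EuclideanSpace ℝ (Fin 3))) := by
    intro s
    by_cases hs : s ∈ GoodT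
    · rw [hUf_good s hs]
      refine ⟨hs.1, ?_⟩
      rw [FunctionSpaces.AubinLions.eLpNorm_two_eq_rpow]
      exact ENNReal.rpow_lt_top_of_nonneg (by norm_num) (hs.2.trans_lt ENNReal.coe_lt_top).ne
    · rw [hUf_bad s hs]; exact MemLp.zero
  -- the pressure representative
  have hplpm : AEStronglyMeasurable (uncurry plp) (volume : Measure (ℝ × EuclideanSpace ℝ (Fin 3))) :=
    hpl0m.congr (hplp_ae.mono fun z hz => by simp only [uncurry]; exact hz.symm)
  have hplp53 : ∀ a b : ℝ, ∫⁻ z in Ioo a b ×ˢ (univ : Set (EuclideanSpace ℝ (Fin 3))), ‖plp z.1 z.2‖ₑ ^ (5 / 3 : ℝ) < ∞ := by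
    intro a b
    have e : (fun z : ℝ × EuclideanSpace ℝ (Fin 3) => ‖plp z.1 z.2‖ₑ ^ (5 / 3 : ℝ)) =ᵐ[volume.restrict (Ioo a b ×ˢ (univ : Set (EuclideanSpace ℝ (Fin 3))))]
        fun z => ‖pl0 z.1 z.2‖ₑ ^ (5 / 3 : ℝ) := ae_restrict_of_ae (hplp_ae.mono fun z hz => by
          show ‖plp z.1 z.2‖ₑ ^ (5 / 3 : ℝ) = ‖pl0 z.1 z.2‖ₑ ^ (5 / 3 : ℝ)
          rw [hz])
    rw [lintegral_congr_ae e]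
    exact hpl053 a b
  have hpwτ' : ∀ (a b R : ℝ) (h : ℝ × EuclideanSpace ℝ (Fin 3) → ℝ),
      MemLp h (5 / 2 : ℝ≥0∞) (volume.restrict (Ioo a b ×ˢ ball (0 : EuclideanSpace ℝ (Fin 3)) R)) →
      Tendsto (fun k => ∫ z in Ioo a b ×ˢ ball (0 : EuclideanSpace ℝ (Fin 3)) R, p (τ k) z.1 z.2 * h z) atTop
        (𝓝 (∫ z in Ioo a b ×ˢ ball (0 : EuclideanSpace ℝ (Fin 3)) R, plp z.1 z.2 * h z)) := by
    intro a b R h hh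
    have e : ∫ z in Ioo a b ×ˢ ball (0 : EuclideanSpace ℝ (Fin 3)) R, plp z.1 z.2 * h z =
        ∫ z in Ioo a b ×ˢ ball (0 : EuclideanSpace ℝ (Fin 3)) R, pl0 z.1 z.2 * h z :=
      integral_congr_ae (ae_restrict_of_ae (hplp_ae.mono fun z hz => by
        show plp z.1 z.2 * h z = pl0 z.1 z.2 * h z
        rw [hz]))
    rw [e]
    exact hpwτ a b R h hh
  ------------------------------------------------------------------
  -- ## Step 3: the hypotheses of the passages to the limit, for `Uf`
  ------------------------------------------------------------------
  have hsq_ae : ∀ k, (fun z : ℝ × EuclideanSpace ℝ (Fin 3) => ‖U (τ k) z.1 z.2 - Uf z.1 z.2‖ₑ ^ 2) =ᵐ[volume]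
      fun z => ‖U (τ k) z.1 z.2 - Ul0 z.1 z.2‖ₑ ^ 2 := fun k => hUf_ae.mono fun z hz => by
    show ‖U (τ k) z.1 z.2 - Uf z.1 z.2‖ₑ ^ 2 = ‖U (τ k) z.1 z.2 - Ul0 z.1 z.2‖ₑ ^ 2
    rw [hz]
  have hcube_ae : ∀ k, (fun z : ℝ × EuclideanSpace ℝ (Fin 3) => ‖U (τ k) z.1 z.2 - Uf z.1 z.2‖ₑ ^ (3 : ℝ)) =ᵐ[volume]
      fun z => ‖U (τ k) z.1 z.2 - Ul0 z.1 z.2‖ₑ ^ (3 : ℝ) := fun k => hUf_ae.mono fun z hz => by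
    show ‖U (τ k) z.1 z.2 - Uf z.1 z.2‖ₑ ^ (3 : ℝ) = ‖U (τ k) z.1 z.2 - Ul0 z.1 z.2‖ₑ ^ (3 : ℝ)
    rw [hz]
  have hconv2 : ∀ n : ℕ, Tendsto (fun k => ∫⁻ z in Ioo (-((n : ℝ) + 1)) ((n : ℝ) + 1) ×ˢ
      ball (0 : EuclideanSpace ℝ (Fin 3)) (n + 1), ‖U (τ k) z.1 z.2 - Uf z.1 z.2‖ₑ ^ 2) atTop (𝓝 0) := by
    intro n
    refine (hconv2τ n).congr fun k => ?_
    exact (lintegral_congr_ae (ae_restrict_of_ae (hsq_ae k))).symm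
  have hconv3 : ∀ n : ℕ, Tendsto (fun k => ∫⁻ z in Ioo (-((n : ℝ) + 1)) ((n : ℝ) + 1) ×ˢ
      ball (0 : EuclideanSpace ℝ (Fin 3)) (n + 1), ‖U (τ k) z.1 z.2 - Uf z.1 z.2‖ₑ ^ (3 : ℝ)) atTop (𝓝 0) := by
    intro n
    refine (hconv3τ n).congr fun k => ?_
    exact (lintegral_congr_ae (ae_restrict_of_ae (hcube_ae k))).symm
  have hM : ∀ n : ℕ, ∃ M : ℝ≥0∞, M < ∞ ∧
      (∀ k, ∫⁻ z in Ioo (-((n : ℝ) + 1)) ((n : ℝ) + 1) ×ˢ ball (0 : EuclideanSpace ℝ (Fin 3)) (n + 1),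
        ‖U (τ k) z.1 z.2‖ₑ ^ (10 / 3 : ℝ) ≤ M) ∧
      ∫⁻ z in Ioo (-((n : ℝ) + 1)) ((n : ℝ) + 1) ×ˢ ball (0 : EuclideanSpace ℝ (Fin 3)) (n + 1),
        ‖Uf z.1 z.2‖ₑ ^ (10 / 3 : ℝ) ≤ M := by
    intro n
    obtain ⟨M, hMt, hUb, hUl0b⟩ := hM0 n
    refine ⟨M, hMt, fun k => hUb _, ?_⟩
    have e : (fun z : ℝ × EuclideanSpace ℝ (Fin 3) => ‖Uf z.1 z.2‖ₑ ^ (10 / 3 : ℝ)) =ᵐ[volume.restrict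
        (Ioo (-((n : ℝ) + 1)) ((n : ℝ) + 1) ×ˢ ball (0 : EuclideanSpace ℝ (Fin 3)) (n + 1))]
        fun z => ‖Ul0 z.1 z.2‖ₑ ^ (10 / 3 : ℝ) := ae_restrict_of_ae (hUf_ae.mono fun z hz => by
          show ‖Uf z.1 z.2‖ₑ ^ (10 / 3 : ℝ) = ‖Ul0 z.1 z.2‖ₑ ^ (10 / 3 : ℝ)
          rw [hz])
    rw [lintegral_congr_ae e]
    exact hUl0b
  -- the weak gradient of `Uf`
  have hGuf : HasWeakSpatialGradientOn (⊤ : Opens (ℝ × EuclideanSpace ℝ (Fin 3))) Uf Gu := by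
    refine hGu0.congr_ae ?_
    rw [Opens.coe_top, Measure.restrict_univ]
    filter_upwards [hUf_ae] with z hz
    simp only [uncurry]
    exact hz.symm
  have hGub : ∀ m : ℕ, ∫⁻ z in Ioo (-((m : ℝ) + 1)) ((m : ℝ) + 1) ×ˢ (univ : Set (EuclideanSpace ℝ (Fin 3))),
      ENNReal.ofReal (frobeniusNormSq (Gu z.1 z.2)) < ∞ := fun m =>
    (hGub0 m).trans_lt (ENNReal.mul_lt_top (ENNReal.mul_lt_top ENNReal.ofNat_lt_top (ENNReal.natCast_lt_top _)) ENNReal.coe_lt_top)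
  -- the mollified drifts converge to `Uf` in `L³` of every cylinder
  have hUf3Q : ∀ n : ℕ, ∫⁻ z in Ioo (-((n : ℝ) + 1)) ((n : ℝ) + 1) ×ˢ ball (0 : EuclideanSpace ℝ (Fin 3)) (n + 1),
      ‖Uf z.1 z.2‖ₑ ^ (3 : ℝ) < ∞ := by
    intro n
    obtain ⟨M, hMt, -, hUfb⟩ := hM n
    haveI : IsFiniteMeasure (volume.restrict (Ioo (-((n : ℝ) + 1)) ((n : ℝ) + 1) ×ˢ ball (0 : EuclideanSpace ℝ (Fin 3)) (n + 1))) :=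
      NSCylinder.isFiniteMeasure_restrict (Ω := ⟨ball (0 : EuclideanSpace ℝ (Fin 3)) (n + 1), isOpen_ball⟩) isBounded_ball _ _
    exact lintegral_rpow_three_lt_top_of_memLp (memLp_three_of_lintegral_tenThirds_le hUfm.restrict hMt hUfb)
  have hmoll : ∀ a b R : ℝ, Tendsto (fun k => eLpNorm (fun z : ℝ × EuclideanSpace ℝ (Fin 3) =>
      mollify η (ε (τ k)) (U (τ k)) z.1 z.2 - Uf z.1 z.2) 3
      (volume.restrict (Ioo a b ×ˢ ball (0 : EuclideanSpace ℝ (Fin 3)) R))) atTop (𝓝 0) := by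
    intro a b R
    obtain ⟨n, hn⟩ := exists_cylinder_subset a b (R + 1)
    have hUl3 : ∫⁻ z in Ioo a b ×ˢ ball (0 : EuclideanSpace ℝ (Fin 3)) (R + 1), ‖Uf z.1 z.2‖ₑ ^ (3 : ℝ) < ∞ :=
      (lintegral_mono_set hn).trans_lt (hUf3Q n)
    have hc3 : Tendsto (fun k => eLpNorm (fun z : ℝ × EuclideanSpace ℝ (Fin 3) => U (τ k) z.1 z.2 - Uf z.1 z.2) 3
        (volume.restrict (Ioo a b ×ˢ ball (0 : EuclideanSpace ℝ (Fin 3)) (R + 1)))) atTop (𝓝 0) := by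
      refine tendsto_eLpNorm_three_of_tendsto_lintegral
        (μ := volume.restrict (Ioo a b ×ˢ ball (0 : EuclideanSpace ℝ (Fin 3)) (R + 1)))
        (f := fun (k : ℕ) (z : ℝ × EuclideanSpace ℝ (Fin 3)) => U (τ k) z.1 z.2 - Uf z.1 z.2) ?_
      exact tendsto_of_tendsto_of_tendsto_of_le_of_le tendsto_const_nhds (hconv3 n) (fun _ => zero_le)
        fun k => lintegral_mono_set hn
    exact tendsto_eLpNorm_mollify_sub_limit hη (U := fun k => U (τ k)) (ε := fun k => ε (τ k)) (fun k => hUm _)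
      (fun k => ((hsol (τ k)).ae_memLp_two_slice).mono fun s hs => hs.1) hUfm (Eventually.of_forall hUf_slice2)
      hUl3 hc3 hετ hετ0
  ------------------------------------------------------------------
  -- ## Step 4: the passages to the limit
  ------------------------------------------------------------------
  have hGg : ∀ k, HasWeakSpatialGradientOn (⊤ : Opens (ℝ × EuclideanSpace ℝ (Fin 3))) (U (τ k)) (G (τ k)) := fun k => (hG _).1
  have hGb : ∀ k, ∫⁻ z in Ioo 0 T ×ˢ (univ : Set (EuclideanSpace ℝ (Fin 3))),
      ENNReal.ofReal (frobeniusNormSq (G (τ k) z.1 z.2)) ≤ C := fun k => (hG _).2.1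
  have hdist := distributional_limit (U := fun k => U (τ k)) (p := fun k => p (τ k)) (ε := fun k => ε (τ k))
    hT hWc1 hη hετ hsolτ hUfm hconv2 hmoll hplpm hplp53 hpwτ'
  have hdiv := ae_isWeaklyDivFree_limit (U := fun k => U (τ k)) (p := fun k => p (τ k)) (ε := fun k => ε (τ k))
    hWc1 hW.divFree hsolτ hUfm (Eventually.of_forall hUf_energy) hconv2
  have hweak := weakForm_limit (U := fun k => U (τ k)) (p := fun k => p (τ k)) (ε := fun k => ε (τ k))
    (G := fun k => G (τ k)) hT hWc1 hW.periodic hη hετ hsolτ hGg hGb (fun k => (hG _).2.2.1) hUfm hconv2 hmoll hGuf hGub hGwκ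
  have hlei := localEnergy_limit (U := fun k => U (τ k)) (p := fun k => p (τ k)) (ε := fun k => ε (τ k))
    (G := fun k => G (τ k)) hT hWc1 hη hετ hsolτ hGg hGb (fun k => (hG _).2.2.2) hUfm hconv2 hconv3 hM hmoll
    hplpm hplp53 hpwτ' hGuf hGub hGwκ
  ------------------------------------------------------------------
  -- ## Step 5: the classes of Definition 2.3 and the assembly
  ------------------------------------------------------------------
  -- the total gradient
  have hGt : HasWeakSpatialGradientOn (⊤ : Opens (ℝ × EuclideanSpace ℝ (Fin 3))) (fun s y => Uf s y + W s y)
      (fun s y => Gu s y + fderiv ℝ (W s) y) := hGuf.add (hasWeakSpatialGradientOn_fderiv_profile hWc1)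
  -- `∇(u − U₀) ∈ L²((0,T) × ℝ³)`
  have hH1 : ∫⁻ z in Ioo 0 T ×ˢ (univ : Set (EuclideanSpace ℝ (Fin 3))),
      ENNReal.ofReal (frobeniusNormSq (Gu z.1 z.2 + fderiv ℝ (W z.1) z.2 - fderiv ℝ (U₀ z.1) z.2)) < ∞ := by
    set K₂ : ℝ≥0∞ := ⨆ s : ℝ, ∫⁻ y, ENNReal.ofReal (frobeniusNormSq (fderiv ℝ (U₀ s) y - fderiv ℝ (W s) y)) with hK₂
    have hpt : ∀ z : ℝ × EuclideanSpace ℝ (Fin 3),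
        ENNReal.ofReal (frobeniusNormSq (Gu z.1 z.2 + fderiv ℝ (W z.1) z.2 - fderiv ℝ (U₀ z.1) z.2)) ≤
          2 * ENNReal.ofReal (frobeniusNormSq (Gu z.1 z.2)) +
            2 * ENNReal.ofReal (frobeniusNormSq (fderiv ℝ (U₀ z.1) z.2 - fderiv ℝ (W z.1) z.2)) := by
      intro z
      have e : Gu z.1 z.2 + fderiv ℝ (W z.1) z.2 - fderiv ℝ (U₀ z.1) z.2 =
          Gu z.1 z.2 + (-(fderiv ℝ (U₀ z.1) z.2 - fderiv ℝ (W z.1) z.2)) := by abel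
      rw [e]
      refine (ENNReal.ofReal_le_ofReal (frobeniusNormSq_add_le _ _)).trans (le_of_eq ?_)
      rw [frobeniusNormSq_neg, ENNReal.ofReal_add (mul_nonneg zero_le_two (frobeniusNormSq_nonneg _))
        (mul_nonneg zero_le_two (frobeniusNormSq_nonneg _)),
        ENNReal.ofReal_mul zero_le_two, ENNReal.ofReal_mul zero_le_two, ENNReal.ofReal_ofNat]
    have hmU : Continuous fun z : ℝ × EuclideanSpace ℝ (Fin 3) => fderiv ℝ (U₀ z.1) z.2 := continuous_fderiv_slice_of_contDiff hU₀.contDiff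
    have hmW : Continuous fun z : ℝ × EuclideanSpace ℝ (Fin 3) => fderiv ℝ (W z.1) z.2 := continuous_fderiv_slice_of_contDiff hWc1
    have hm2 : Measurable fun z : ℝ × EuclideanSpace ℝ (Fin 3) =>
        ENNReal.ofReal (frobeniusNormSq (fderiv ℝ (U₀ z.1) z.2 - fderiv ℝ (W z.1) z.2)) :=
      (LerayHopfProofs.continuous_frobeniusNormSq.comp (hmU.sub hmW)).measurable.ennreal_ofReal
    have hGum : AEStronglyMeasurable (fun z : ℝ × EuclideanSpace ℝ (Fin 3) => Gu z.1 z.2) (volume : Measure (ℝ × EuclideanSpace ℝ (Fin 3))) := by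
      have h := hGu0.locallyIntegrableOn_grad.aestronglyMeasurable
      rwa [Opens.coe_top, Measure.restrict_univ] at h
    have hm1 : AEMeasurable (fun z : ℝ × EuclideanSpace ℝ (Fin 3) => ENNReal.ofReal (frobeniusNormSq (Gu z.1 z.2)))
        (volume.restrict (Ioo 0 T ×ˢ (univ : Set (EuclideanSpace ℝ (Fin 3))))) :=
      (LerayHopfProofs.continuous_frobeniusNormSq.comp_aestronglyMeasurable hGum).aemeasurable.ennreal_ofReal.restrict
    -- the `Gu`-part: inside the slab `m = ⌈T⌉₊`
    have hGuT : ∫⁻ z in Ioo 0 T ×ˢ (univ : Set (EuclideanSpace ℝ (Fin 3))), ENNReal.ofReal (frobeniusNormSq (Gu z.1 z.2)) < ∞ := by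
      refine (lintegral_mono_set ?_).trans_lt (hGub ⌈T⌉₊)
      refine prod_mono (fun s hs => ⟨?_, ?_⟩) Subset.rfl
      · linarith [hs.1, (Nat.cast_nonneg ⌈T⌉₊ : (0 : ℝ) ≤ ⌈T⌉₊)]
      · linarith [hs.2, Nat.le_ceil T]
    -- the profile part: `T · sup_s ∫ |D(U₀ − W)|²`
    have hWT : ∫⁻ z in Ioo 0 T ×ˢ (univ : Set (EuclideanSpace ℝ (Fin 3))),
        ENNReal.ofReal (frobeniusNormSq (fderiv ℝ (U₀ z.1) z.2 - fderiv ℝ (W z.1) z.2)) < ∞ := by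
      rw [FunctionSpaces.AubinLions.volume_restrict_prod, Measure.restrict_univ, lintegral_prod _ hm2.aemeasurable]
      calc ∫⁻ s in Ioo 0 T, ∫⁻ y, ENNReal.ofReal (frobeniusNormSq (fderiv ℝ (U₀ (s, y).1) (s, y).2 - fderiv ℝ (W (s, y).1) (s, y).2))
          ≤ ∫⁻ s in Ioo 0 T, K₂ := lintegral_mono fun s => le_iSup (fun s : ℝ => ∫⁻ y, ENNReal.ofReal
              (frobeniusNormSq (fderiv ℝ (U₀ s) y - fderiv ℝ (W s) y))) s
        _ = K₂ * volume (Ioo (0 : ℝ) T) := by rw [lintegral_const, Measure.restrict_apply_univ]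
        _ < ∞ := ENNReal.mul_lt_top h2 (by rw [Real.volume_Ioo]; exact ENNReal.ofReal_lt_top)
    calc ∫⁻ z in Ioo 0 T ×ˢ (univ : Set (EuclideanSpace ℝ (Fin 3))),
          ENNReal.ofReal (frobeniusNormSq (Gu z.1 z.2 + fderiv ℝ (W z.1) z.2 - fderiv ℝ (U₀ z.1) z.2))
        ≤ ∫⁻ z in Ioo 0 T ×ˢ (univ : Set (EuclideanSpace ℝ (Fin 3))), (2 * ENNReal.ofReal (frobeniusNormSq (Gu z.1 z.2)) +
            2 * ENNReal.ofReal (frobeniusNormSq (fderiv ℝ (U₀ z.1) z.2 - fderiv ℝ (W z.1) z.2))) := lintegral_mono hpt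
      _ = 2 * (∫⁻ z in Ioo 0 T ×ˢ (univ : Set (EuclideanSpace ℝ (Fin 3))), ENNReal.ofReal (frobeniusNormSq (Gu z.1 z.2))) +
          2 * ∫⁻ z in Ioo 0 T ×ˢ (univ : Set (EuclideanSpace ℝ (Fin 3))),
            ENNReal.ofReal (frobeniusNormSq (fderiv ℝ (U₀ z.1) z.2 - fderiv ℝ (W z.1) z.2)) := by
          rw [lintegral_add_left' (hm1.const_mul _), lintegral_const_mul'' _ hm1, lintegral_const_mul' _ _ ENNReal.ofNat_ne_top]
      _ < ∞ := ENNReal.add_lt_top.2 ⟨ENNReal.mul_lt_top ENNReal.ofNat_lt_top hGuT, ENNReal.mul_lt_top ENNReal.ofNat_lt_top hWT⟩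
  -- the energy class
  have hK₁ : (⨆ s : ℝ, ∫⁻ y, ‖U₀ s y - W s y‖ₑ ^ 2) ≠ ∞ := h1.ne
  have henergy : ∀ s, ∫⁻ y, ‖Uf s y + W s y - U₀ s y‖ₑ ^ 2 ≤ 2 * C + 2 * ⨆ s : ℝ, ∫⁻ y, ‖U₀ s y - W s y‖ₑ ^ 2 := by
    intro s
    have hpt : ∀ y, ‖Uf s y + W s y - U₀ s y‖ₑ ^ 2 ≤ 2 * (‖Uf s y‖ₑ ^ 2 + ‖U₀ s y - W s y‖ₑ ^ 2) := by
      intro y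
      have e : Uf s y + W s y - U₀ s y = Uf s y - (U₀ s y - W s y) := by abel
      rw [e]
      exact FunctionSpaces.AubinLions.enorm_sub_sq_le _ _
    have hm : AEMeasurable (fun y => ‖Uf s y‖ₑ ^ 2) (volume : Measure (EuclideanSpace ℝ (Fin 3))) :=
      (hUf_slice2 s).1.enorm.pow_const 2
    calc ∫⁻ y, ‖Uf s y + W s y - U₀ s y‖ₑ ^ 2 ≤ ∫⁻ y, 2 * (‖Uf s y‖ₑ ^ 2 + ‖U₀ s y - W s y‖ₑ ^ 2) := lintegral_mono hpt
      _ = 2 * (∫⁻ y, ‖Uf s y‖ₑ ^ 2) + 2 * ∫⁻ y, ‖U₀ s y - W s y‖ₑ ^ 2 := by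
          rw [lintegral_const_mul' _ _ ENNReal.ofNat_ne_top, lintegral_add_left' hm, mul_add]
      _ ≤ 2 * C + 2 * ⨆ s : ℝ, ∫⁻ y, ‖U₀ s y - W s y‖ₑ ^ 2 := by
          gcongr
          · exact hUf_energy s
          · exact le_iSup (fun s : ℝ => ∫⁻ y, ‖U₀ s y - W s y‖ₑ ^ 2) s
  set Ce : ℝ≥0 := (2 * (C : ℝ≥0∞) + 2 * ⨆ s : ℝ, ∫⁻ y, ‖U₀ s y - W s y‖ₑ ^ 2).toNNReal with hCe
  have hCe' : ((Ce : ℝ≥0) : ℝ≥0∞) = 2 * (C : ℝ≥0∞) + 2 * ⨆ s : ℝ, ∫⁻ y, ‖U₀ s y - W s y‖ₑ ^ 2 := by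
    rw [hCe, ENNReal.coe_toNNReal]
    exact ENNReal.add_ne_top.2 ⟨ENNReal.mul_ne_top ENNReal.ofNat_ne_top ENNReal.coe_ne_top, ENNReal.mul_ne_top ENNReal.ofNat_ne_top hK₁⟩
  -- the pressure classes
  have hploc : LocallyIntegrable (uncurry plp) (volume : Measure (ℝ × EuclideanSpace ℝ (Fin 3))) := by
    refine (locallyIntegrable_iff (μ := (volume : Measure (ℝ × EuclideanSpace ℝ (Fin 3))))).2 fun K hK => ?_
    obtain ⟨n, hn⟩ := exists_subset_cylinder_of_isCompact hK
    exact (integrableOn_cylinder_of_lintegral_fiveThirds hplpm hplp53 _ _ _).mono_set hn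
  have hp32 : ∀ K : Set (ℝ × EuclideanSpace ℝ (Fin 3)), IsCompact K →
      ∫⁻ z in K, ‖plp z.1 z.2‖ₑ ^ (3 / 2 : ℝ) < ∞ := by
    intro K hK
    obtain ⟨n, hn⟩ := exists_subset_cylinder_of_isCompact hK
    refine (lintegral_mono_set hn).trans_lt ?_
    set S : Set (ℝ × EuclideanSpace ℝ (Fin 3)) := Ioo (-((n : ℝ) + 1)) ((n : ℝ) + 1) ×ˢ ball (0 : EuclideanSpace ℝ (Fin 3)) (n + 1) with hS
    haveI : IsFiniteMeasure (volume.restrict S) :=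
      NSCylinder.isFiniteMeasure_restrict (Ω := ⟨ball (0 : EuclideanSpace ℝ (Fin 3)) (n + 1), isOpen_ball⟩) isBounded_ball _ _
    have hm : AEMeasurable (fun z : ℝ × EuclideanSpace ℝ (Fin 3) => ‖plp z.1 z.2‖ₑ) (volume.restrict S) := hplpm.restrict.enorm
    refine (lintegral_rpow_threeHalves_le_of_fiveThirds _ hm).trans_lt ?_
    exact ENNReal.mul_lt_top (ENNReal.rpow_lt_top_of_nonneg (by norm_num) (measure_ne_top (volume.restrict S) _))
      (ENNReal.rpow_lt_top_of_nonneg (by norm_num) ((lintegral_mono_set (prod_mono Subset.rfl (subset_univ _))).trans_lt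
        (hplp53 _ _)).ne)
  -- the assembly
  refine ⟨fun s y => Uf s y + W s y, plp, ?_, ?_⟩
  · exact
      { periodic := fun s y => by
          show Uf (s + T) y + W (s + T) y = Uf s y + W s y
          rw [hUf_per, hW.periodic]
        periodic_pressure := hplp_per
        divFree := hdiv
        energy := ⟨Ce, fun s => by rw [hCe']; exact henergy s⟩
        locallyIntegrable_pressure := hploc
        pressure_threeHalves := hp32
        distributional := hdist
        weakForm := ⟨fun s y => Gu s y + fderiv ℝ (W s) y, hGt, hH1, hweak, hlei⟩ }
  · exact hplp53 0 T

end Discharge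

end BradshawTsai2017

end Literature.Analysis.FluidPDE

end
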